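import Summits.KontsevichZagierPeriods.Zeta5Search.Barrier.ConeGammaPhiNRate

/-!
# ζ(5) search — BARRIER: the bookkeeping identity `δ₂₈ = m₁ + ⋯ + m₅`, hence `DenominatorRate` on the whole box

HONEST FRAMING (cell `pub-zeta5`): systematic search; no irrationality claim unless kernel-certified. MODEL objects
under Brown–Zudilin's (28)+(30) accounting ([BZ22] = arXiv:2210.03391); nothing here is a statement about `ζ(5)`;
records in print UNMOVED. Sequel of `ConeGammaPhiNRate` (theory seat cert-2 g17, WAKE w3 of lead/lit g23): the
last hypothesis of `denominatorRate_of_delta28_eq` — the sorting identity «the maximum over 5-element index sets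
of `Σ_{i∈S} h_i` equals the sum of the five largest entries of the multiset `h`» — is proved for every integer
parameter vector of the closed box, so **`denominatorRate_of_BZBox : BZBox (realDir a) → DenominatorRate a`**:
the ANALYTIC identification `(1/n) log (D_n/Φ_n) → δ₂₈ − Φ` of `ConeGammaAccounting` is a theorem on the whole
closed box (prime number theorem + the exact period formula + this bookkeeping).

* `hSortedDesc a` — the multiset `h(a)` sorted in decreasing order (`mIdx a k` is its `k`-th entry);
* `delta28_le_sum_top_five` — via the tree's threshold certificate `delta28_le_threshold` at `τ = m₅` and
  permutation invariance of full sums; `sum_top_five_le_delta28` — the five largest entries sit at five distinct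
  positions (`List.sublist_iff_exists_fin_orderEmbedding_get_eq`), and `le_delta28`;
* **`delta28_realDir_eq_sum_mIdx`**, **`denominatorRate_of_BZBox`**.
-/

noncomputable section

open Set

namespace Summit.KontsevichZagierPeriods.Zeta5Search.Barrier.ConeGamma

open Literature.NumberTheory.Irrationality.BrownZudilin2022 (hList hForm)

/-! ### The sorted multiset -/

/-- The 28-multiset `h(a)` sorted in DECREASING order (`mIdx a k` is its `k`-th entry). -/
def hSortedDesc (a : Fin 8 → ℤ) : List ℤ := ((hList a).insertionSort (· ≤ ·)).reverse

/-- `m_{k+1} = hSortedDesc[k]`. -/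
theorem mIdx_eq_getD (a : Fin 8 → ℤ) (k : ℕ) : mIdx a k = (hSortedDesc a).getD k 0 := rfl

/-- The sorted list is a permutation of `h(a)`. -/
theorem hSortedDesc_perm (a : Fin 8 → ℤ) : (hSortedDesc a).Perm (hList a) :=
  (List.reverse_perm _).trans (List.perm_insertionSort _ _)

/-- `h(a)` has 28 entries. -/
theorem hList_length (a : Fin 8 → ℤ) : (hList a).length = 28 := rfl

/-- The sorted list has 28 entries. -/
theorem hSortedDesc_length (a : Fin 8 → ℤ) : (hSortedDesc a).length = 28 := by
  rw [(hSortedDesc_perm a).length_eq]; rfl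

/-- The sorted list is decreasing. -/
theorem hSortedDesc_pairwise (a : Fin 8 → ℤ) : (hSortedDesc a).Pairwise (fun u v => v ≤ u) := by
  unfold hSortedDesc
  rw [List.pairwise_reverse]
  exact List.pairwise_insertionSort _ _

/-- Decreasing: `i ≤ j ⇒ R[j] ≤ R[i]`. -/
theorem hSortedDesc_anti (a : Fin 8 → ℤ) {i j : ℕ} (hij : i ≤ j) (hj : j < 28) :
    (hSortedDesc a).getD j 0 ≤ (hSortedDesc a).getD i 0 := by
  have hl := hSortedDesc_length a
  rw [List.getD_eq_getElem _ _ (by omega), List.getD_eq_getElem _ _ (by omega)]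
  rcases hij.eq_or_lt with h | h
  · subst h; exact le_rfl
  · exact List.pairwise_iff_getElem.mp (hSortedDesc_pairwise a) i j (by omega) (by omega) h

/-- The forms of an integer vector are the entries of `h(a)`: `h28 (realDir a) k = hList[k]`. -/
theorem h28_realDir_eq_getD (a : Fin 8 → ℤ) (k : Fin 28) : h28 (realDir a) k = ((hList a).getD k 0 : ℝ) := by
  rw [h28_realDir]
  unfold hForm
  rw [Nat.add_sub_cancel]

/-- A `Fin n`-indexed sum through `getD` of a list of length `n` is the list sum. -/
theorem sum_fin_getD_eq_sum_map {n : ℕ} (l : List ℤ) (hl : l.length = n) (g : ℤ → ℝ) :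
    ∑ k : Fin n, g (l.getD k 0) = (l.map g).sum := by
  induction l generalizing n with
  | nil => subst hl; simp
  | cons x t ih =>
    subst hl
    rw [List.length_cons, Fin.sum_univ_succ]
    simp only [Fin.val_zero, List.getD_cons_zero, Fin.val_succ, List.getD_cons_succ, List.map_cons,
      List.sum_cons]
    rw [ih rfl]

/-- **Permutation invariance of full sums**: `Σ_k g(h_k) = Σ_k g(R_k)` for the sorted list `R`. -/
theorem sum_h28_eq_sum_sorted (a : Fin 8 → ℤ) (g : ℤ → ℝ) :
    ∑ k : Fin 28, g ((hList a).getD k 0) = ∑ k : Fin 28, g ((hSortedDesc a).getD k 0) := by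
  rw [sum_fin_getD_eq_sum_map _ (hList_length a), sum_fin_getD_eq_sum_map _ (hSortedDesc_length a)]
  exact ((hSortedDesc_perm a).map g).sum_eq.symm

/-! ### Upper bound: the threshold certificate at `τ = m₅` -/

/-- **`δ₂₈ ≤ m₁ + ⋯ + m₅`.** -/
theorem delta28_le_sum_top_five (a : Fin 8 → ℤ) :
    delta28 (realDir a) ≤ ∑ k : Fin 5, ((hSortedDesc a).getD k 0 : ℝ) := by
  set R := hSortedDesc a with hR
  set τ : ℝ := (R.getD 4 0 : ℝ) with hτ
  have hth := delta28_le_threshold (realDir a) τ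
  -- rewrite the threshold sum through the sorted list
  have h1 : ∑ i : Fin 28, max (h28 (realDir a) i - τ) 0 = ∑ k : Fin 28, max ((R.getD k 0 : ℝ) - τ) 0 := by
    have := sum_h28_eq_sum_sorted a (fun x => max ((x : ℝ) - τ) 0)
    simp only [h28_realDir_eq_getD]
    exact this
  -- in the sorted list: the first five terms are `R_k − τ`, the others vanish
  have h2 : ∀ k : Fin 28, max ((R.getD k 0 : ℝ) - τ) 0 = if k.val < 5 then (R.getD k 0 : ℝ) - τ else 0 := by
    intro k
    split_ifs with hk
    · have : R.getD 4 0 ≤ R.getD k 0 := hSortedDesc_anti a (by omega) (by norm_num)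
      rw [max_eq_left]
      rw [hτ]; exact_mod_cast sub_nonneg.mpr this
    · have : R.getD k 0 ≤ R.getD 4 0 := hSortedDesc_anti a (by omega) k.isLt
      rw [max_eq_right]
      rw [hτ]; exact_mod_cast sub_nonpos.mpr this
  have h3 : ∑ k : Fin 28, (if k.val < 5 then (R.getD k 0 : ℝ) - τ else 0) =
      ∑ k : Fin 5, ((R.getD k 0 : ℝ) - τ) := by
    rw [Fin.sum_univ_eq_sum_range (fun i => if i < 5 then (R.getD i 0 : ℝ) - τ else 0) 28,
      Fin.sum_univ_eq_sum_range (fun i => (R.getD i 0 : ℝ) - τ) 5,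
      ← Finset.sum_range_add_sum_Ico _ (show 5 ≤ 28 by norm_num)]
    rw [Finset.sum_congr rfl fun i hi => if_pos (Finset.mem_range.mp hi),
      Finset.sum_eq_zero fun i hi => if_neg (by have := (Finset.mem_Ico.mp hi).1; omega), add_zero]
  calc delta28 (realDir a) ≤ 5 * τ + ∑ i : Fin 28, max (h28 (realDir a) i - τ) 0 := hth
    _ = 5 * τ + ∑ k : Fin 5, ((R.getD k 0 : ℝ) - τ) := by
        rw [h1, Finset.sum_congr rfl fun k _ => h2 k, h3]
    _ = ∑ k : Fin 5, (R.getD k 0 : ℝ) := by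
        rw [Finset.sum_sub_distrib, Finset.sum_const, Finset.card_univ, Fintype.card_fin]
        ring

/-! ### Lower bound: the five largest entries occupy five positions -/

/-- **`m₁ + ⋯ + m₅ ≤ δ₂₈`.** -/
theorem sum_top_five_le_delta28 (a : Fin 8 → ℤ) :
    ∑ k : Fin 5, ((hSortedDesc a).getD k 0 : ℝ) ≤ delta28 (realDir a) := by
  set R := hSortedDesc a with hR
  have hRl : R.length = 28 := hSortedDesc_length a
  -- the prefix of length 5 is a sub-permutation of `h(a)`
  have hsub : (R.take 5).Subperm (hList a) :=
    ((List.take_sublist 5 R).subperm).trans (hSortedDesc_perm a).subperm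
  obtain ⟨l, hlperm, hlsub⟩ := hsub
  have hl5 : l.length = 5 := by rw [hlperm.length_eq]; simp [List.length_take, hRl]
  obtain ⟨f, hf⟩ := List.sublist_iff_exists_fin_orderEmbedding_get_eq.mp hlsub
  -- the five positions
  let emb : Fin l.length ↪ Fin 28 :=
    ⟨fun ix => Fin.cast (hList_length a) (f ix), fun i j hij => f.injective (Fin.cast_injective _ hij)⟩
  set S : Finset (Fin 28) := Finset.univ.map emb with hS
  have hScard : S.card = 5 := by rw [hS, Finset.card_map, Finset.card_univ, Fintype.card_fin, hl5]
  have hle := le_delta28 (realDir a) hScard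
  -- the sum over the five positions is the sum of the prefix
  have hsum : ∑ i ∈ S, h28 (realDir a) i = ∑ k : Fin 5, (R.getD k 0 : ℝ) := by
    rw [hS, Finset.sum_map]
    have e1 : ∀ ix : Fin l.length, h28 (realDir a) (emb ix) = (l.get ix : ℝ) := by
      intro ix
      rw [hf ix, h28_realDir_eq_getD]
      simp [emb, List.get_eq_getElem]
    rw [Finset.sum_congr rfl fun ix _ => e1 ix]
    -- `Σ_ix l[ix] = (l.map cast).sum = ((R.take 5).map cast).sum = Σ_{k<5} R_k`
    have e2 : ∑ ix : Fin l.length, (l.get ix : ℝ) = (l.map (fun x : ℤ => (x : ℝ))).sum := by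
      rw [← sum_fin_getD_eq_sum_map l rfl]
      refine Finset.sum_congr rfl fun ix _ => ?_
      rw [List.getD_eq_getElem _ _ ix.isLt, List.get_eq_getElem]
    have e3 : (l.map (fun x : ℤ => (x : ℝ))).sum = ((R.take 5).map (fun x : ℤ => (x : ℝ))).sum :=
      (hlperm.map _).sum_eq
    have e4 : ((R.take 5).map (fun x : ℤ => (x : ℝ))).sum = ∑ k : Fin 5, (R.getD k 0 : ℝ) := by
      rw [← sum_fin_getD_eq_sum_map (n := 5) (R.take 5) (by simp [List.length_take, hRl])]
      refine Finset.sum_congr rfl fun k _ => ?_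
      rw [List.getD_eq_getElem _ _ (by rw [List.length_take, hRl]; omega),
        List.getD_eq_getElem _ _ (by rw [hRl]; omega), List.getElem_take]
    rw [e2, e3, e4]
  rw [← hsum]
  exact hle

/-! ### The identity and `DenominatorRate` on the box -/

/-- Entries of `h(a)` are non-negative on the box, so `(m_k).toNat = m_k`. -/
theorem mIdx_toNat_cast {a : Fin 8 → ℤ} (ha : BZBox (realDir a)) (k : Fin 5) :
    (((mIdx a k).toNat : ℕ) : ℝ) = ((hSortedDesc a).getD k 0 : ℝ) := by
  rw [mIdx_eq_getD]
  have hk : (k : ℕ) < (hSortedDesc a).length := by rw [hSortedDesc_length]; omega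
  have hmem : (hSortedDesc a).getD k 0 ∈ hList a := by
    rw [List.getD_eq_getElem _ _ hk]
    exact (hSortedDesc_perm a).subset (List.getElem_mem _)
  obtain ⟨j, hj, hjeq⟩ := List.getElem_of_mem hmem
  have hnn : (0 : ℝ) ≤ ((hSortedDesc a).getD k 0 : ℝ) := by
    have h := h28_nonneg_of_BZBox ha ⟨j, by rw [hList_length] at hj; exact hj⟩
    rw [h28_realDir_eq_getD] at h
    simp only at h
    rwa [List.getD_eq_getElem _ _ hj, hjeq] at h
  have hnn' : 0 ≤ (hSortedDesc a).getD k 0 := by exact_mod_cast hnn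
  have : (((hSortedDesc a).getD (↑k) 0).toNat : ℤ) = (hSortedDesc a).getD k 0 := Int.toNat_of_nonneg hnn'
  exact_mod_cast this

/-- **THE BOOKKEEPING IDENTITY `δ₂₈(a) = m₁ + ⋯ + m₅`** for every integer parameter vector of the closed box
(maximum over 5-element index sets of `Σ h_i` = sum of the five largest entries of the multiset `h`). -/
theorem delta28_realDir_eq_sum_mIdx {a : Fin 8 → ℤ} (ha : BZBox (realDir a)) :
    delta28 (realDir a) = ∑ k : Fin 5, ((mIdx a k).toNat : ℝ) := by
  rw [Finset.sum_congr rfl fun k _ => mIdx_toNat_cast ha k]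
  exact le_antisymm (delta28_le_sum_top_five a) (sum_top_five_le_delta28 a)

/-- **`DenominatorRate` HOLDS ON THE WHOLE CLOSED BOX**: for every integer parameter vector `a` with
`realDir a ∈ BZBox`, `(1/n) log (D_n(a)/Φ_n(a)) → δ₂₈(a) − Φ(a)` — the ANALYTIC identification named in
`ConeGammaAccounting` is a theorem (PNT for `D_n`, PNT with fractional-part classes + the exact period formula for
`Φ_n`, and the bookkeeping identity above). What `exponent_of_accounting` still takes as hypotheses:
`RatesIdentified` (Poincaré–Perron) and the arithmetic rungs `Law28`/`Law30`. -/
theorem denominatorRate_of_BZBox {a : Fin 8 → ℤ} (ha : BZBox (realDir a)) : DenominatorRate a :=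
  denominatorRate_of_delta28_eq ha (delta28_realDir_eq_sum_mIdx ha)

end Summit.KontsevichZagierPeriods.Zeta5Search.Barrier.ConeGamma

end
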